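import Literature.Geometry.Symplectic.JHolomorphicLimitEmbedded
import Literature.Geometry.Symplectic.JHolomorphicLocalIntersections
import Summits.SmoothPoincare4.SmoothPoincare4.Theorems.SullivanDualWitnessChargeLimitEmbeddedLocalAux
import Mathlib.Analysis.Convex.Topology

/-!
# McDuff's limit theorem (input L1b of crux `WitnessCharge`) from five LOCAL facts

Crux `WitnessCharge` (stmt-SmoothPoincare4-7824), line `Sketch`, continuation lead c5 (cycle 5).
The named fact `Literature.Geometry.Symplectic.jHolomorphicLimitOfEmbedded_isEmbedded`
(McDuff 1991 §4: a locally uniform limit `G` of embedded `J`-holomorphic planes which embeds a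
separating collar `r₀ < |ξ| < r₁` is an injective immersion on `|ξ| < r₁`; filed by lead c4, the
input L1b of skeleton v7c/v8) is PROVED here from the five local named facts of
`Literature/Geometry/Symplectic/JHolomorphicLocalIntersections.lean` (McDuff 1991 Lemma 2.3,
Lemma 2.7, Thm 1.1, Thm 1.4 / Cor. 4.4, and Wendl's local factorization Thm 2.88):
`jHolomorphicLimitOfEmbedded_isEmbedded_of_local` (registered helper), by the following
elementary argument. All pairs of distinct points of the disc with the same image lie in the
inner closed disc (collar injectivity + separation). Let `N ⊆ closedBall 0 r₀` be the set of
points of the open disc having a distinct partner with the same image. (i) `N` is open: at a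
regular point `t ∈ N` with partner `s`, the branches of `G` at `s` and `t` either meet in
isolation — then the embedded approximants `uₙ(· + s)`, `uₙ(· + t)` meet for large `n`
(persistence), contradicting injectivity of `uₙ` — or have the same image germ, so every point
near `t` has a partner near `s`; a critical point of `G` is of branched type (an injective
critical germ is excluded by the no-cusp fact applied to `G(· + c)` and the `uₙ(· + c)`), so a
punctured neighbourhood lies in `N`. (ii) `closure N` is open as well: a point of
`closure N ∖ N` is not locally injective (limits of partner pairs, compactness of the inner closed
disc), hence critical, hence branched. So `closure N` is clopen in the connected disc and misses
the collar point `(r₀ + r₁)/2`: it is empty, `G` is injective on the disc, and a critical point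
would create points of `N`. Unique continuation (fact 1) is only used to know that `G` is
nowhere locally constant (else `dG ≡ 0`, contradicting the immersed collar).
-/

noncomputable section

set_option linter.dupNamespace false

open scoped Manifold ContDiff Topology
open Set Filter

namespace Summit.SmoothPoincare4.SmoothPoincare4.Theorems.WitnessCharge.PencilIncompleteness

open Literature.Geometry.Symplectic

/-! ### The reduction -/

/-- **McDuff's limit theorem from the five local facts.** GIVEN unique continuation from open
sets, the local branch dichotomy, the intersection dichotomy, the persistence of isolated
intersections and the absence of cusps in limits of embedded curves (the named facts of
`Literature/Geometry/Symplectic/JHolomorphicLocalIntersections.lean`), the named fact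
`jHolomorphicLimitOfEmbedded_isEmbedded` (McDuff 1991 §4: a locally uniform limit `G` of embedded
`J`-planes which embeds a separating collar `r₀ < |ξ| < r₁` is embedded on `|ξ| < r₁`) holds.
Proof: every pair of distinct points of the disc with the same image lies in the closed inner
disc (collar injectivity + separation); the non-injectivity locus `N ⊆ closedBall 0 r₀` is open —
at a regular point of `N` the two branches either meet in isolation (then the approximating
embedded curves would meet: persistence, contradiction) or have the same image germ (then all
nearby points have partners), and a critical point is of branched type (an injective critical germ
is excluded by the no-cusp fact), so a punctured neighbourhood lies in `N` — and its closure is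
open too (a limit of points of `N` outside `N` is not locally injective, hence critical, hence
branched), so `closure N` is a clopen subset of the connected disc inside the inner closed disc:
empty. Injectivity follows, and a critical point would produce points of `N`. -/
theorem jHolomorphicLimitOfEmbedded_isEmbedded_of_local :
    Literature.Geometry.Symplectic.jHolomorphic_uniqueContinuation_const →
    Literature.Geometry.Symplectic.jHolomorphic_localBranchDichotomy →
    Literature.Geometry.Symplectic.jHolomorphic_intersectionDichotomy →
    Literature.Geometry.Symplectic.jHolomorphic_isolatedIntersection_persists →
    Literature.Geometry.Symplectic.jHolomorphic_immersed_of_limitEmbedded_punctured →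
    Literature.Geometry.Symplectic.jHolomorphicLimitOfEmbedded_isEmbedded := by
  intro hUC hLoc hInt hPos hCusp V _ _ _ _ _ J hJ2 hJs N ι hιe hιs hιd u G r₀ r₁ hr₀ hr₁ hus huJ
    huinj huimm hGs hGJ hconv hinjA himmA hsep
  -- (1) partners live in the inner closed disc
  have O1 : ∀ s t : ℂ, ‖s‖ < r₁ → ‖t‖ < r₁ → s ≠ t → G s = G t → ‖t‖ ≤ r₀ ∧ ‖s‖ ≤ r₀ := by
    have key : ∀ a b : ℂ, ‖a‖ < r₁ → ‖b‖ < r₁ → a ≠ b → G a = G b → ‖b‖ ≤ r₀ := by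
      intro a b ha hb hab hGab
      by_contra hb'
      rw [not_le] at hb'
      by_cases ha' : r₀ < ‖a‖
      · exact hab (hinjA ⟨ha', ha⟩ ⟨hb', hb⟩ hGab)
      · rw [not_lt] at ha'
        exact hsep a b ha' hb' hb hGab
    intro s t hs ht hne hG
    exact ⟨key s t hs ht hne hG, key t s ht hs hne.symm hG.symm⟩
  -- a point of the collar
  set ξ₀ : ℂ := (((r₀ + r₁) / 2 : ℝ) : ℂ) with hξ₀def
  have hξ₀n : ‖ξ₀‖ = (r₀ + r₁) / 2 := norm_midpoint_cast hr₀ hr₁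
  have hξ₀A : r₀ < ‖ξ₀‖ ∧ ‖ξ₀‖ < r₁ := by rw [hξ₀n]; constructor <;> linarith
  -- (2) `G` is nowhere locally constant
  have NC : ∀ t : ℂ, ∃ᶠ z in 𝓝 t, G z ≠ G t := by
    intro t
    by_contra h
    have hev : ∀ᶠ z in 𝓝 t, G z = G t := by
      simpa only [Filter.not_frequently, not_not] using h
    have hconst := hUC V J hJ2 hJs G hGs hGJ t hev
    have hGeq : G = fun _ => G t := funext hconst
    have hzero : mfderiv 𝓘(ℝ, ℂ) (𝓡 4) G ξ₀ = 0 := by rw [hGeq]; exact mfderiv_const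
    have hinj := himmA ξ₀ hξ₀A.1 hξ₀A.2
    rw [hzero] at hinj
    have h10 : (1 : ℂ) = (0 : ℂ) := @hinj (1 : ℂ) (0 : ℂ) (by simp)
    exact one_ne_zero h10
  have NCs : ∀ c : ℂ, ∃ᶠ z in 𝓝 (0 : ℂ), G (z + c) ≠ G (0 + c) := by
    intro c
    have h := NC c
    rw [← map_add_right_nhds_zero c, Filter.frequently_map] at h
    simpa only [zero_add] using h
  -- (3) shifted data
  have hGc : ∀ c : ℂ, ContMDiff 𝓘(ℝ, ℂ) (𝓡 4) ∞ (fun z : ℂ => G (z + c)) := fun c =>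
    contMDiff_comp_add_const hGs c
  have hGJc : ∀ c : ℂ, IsJHolomorphic (𝓡 4) J (fun z : ℂ => G (z + c)) := fun c =>
    isJHolomorphic_comp_add_const hGs hGJ c
  have huc : ∀ (n : ℕ) (c : ℂ), ContMDiff 𝓘(ℝ, ℂ) (𝓡 4) ∞ (fun z : ℂ => u n (z + c)) :=
    fun n c => contMDiff_comp_add_const (hus n) c
  have huJc : ∀ (n : ℕ) (c : ℂ), IsJHolomorphic (𝓡 4) J (fun z : ℂ => u n (z + c)) :=
    fun n c => isJHolomorphic_comp_add_const (hus n) (huJ n) c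
  have huinjc : ∀ (n : ℕ) (c : ℂ), Function.Injective (fun z : ℂ => u n (z + c)) :=
    fun n c a b h => add_right_cancel (huinj n h)
  have huimmc : ∀ (n : ℕ) (c z : ℂ),
      Function.Injective (mfderiv 𝓘(ℝ, ℂ) (𝓡 4) (fun z : ℂ => u n (z + c)) z) := by
    intro n c z
    rw [mfderiv_comp_add_const (hus n)]
    exact huimm n (z + c)
  have hconvc : ∀ (c : ℂ) (ρ : ℝ), TendstoUniformlyOn (fun n z => ι (u n (z + c)))
      (fun z => ι (G (z + c))) atTop (Metric.closedBall (0 : ℂ) ρ) :=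
    fun c ρ => tendstoUniformlyOn_comp_add_const hconv c ρ
  -- (4) regular points are locally injective
  have LI : ∀ t : ℂ, Function.Injective (mfderiv 𝓘(ℝ, ℂ) (𝓡 4) G t) →
      ∃ ρ : ℝ, 0 < ρ ∧ Set.InjOn G (Metric.ball t ρ) :=
    fun t ht => exists_injOn_ball_of_mfderiv_injective hιs hιd hGs ht
  -- (5) a critical point is of branched type (an injective critical germ would be a cusp)
  have hMC : ∀ c : ℂ, ¬ Function.Injective (mfderiv 𝓘(ℝ, ℂ) (𝓡 4) G c) →
      ∀ ρ : ℝ, 0 < ρ → ∃ ρ' : ℝ, 0 < ρ' ∧ ∀ t ∈ Metric.ball c ρ', t ≠ c →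
        ∃ s ∈ Metric.ball c ρ, s ≠ t ∧ G s = G t := by
    intro c hc
    rcases hLoc V J hJ2 hJs G hGs hGJ c (NC c) with ⟨ρ₁, hρ₁, hinj1, himm1⟩ | h2
    · exfalso
      apply hc
      have hinj' : Set.InjOn (fun z : ℂ => G (z + c)) (Metric.ball (0 : ℂ) ρ₁) := by
        intro a ha b hb hab
        have ha' : a + c ∈ Metric.ball c ρ₁ := by
          simpa [Metric.mem_ball, dist_eq_norm] using ha
        have hb' : b + c ∈ Metric.ball c ρ₁ := by
          simpa [Metric.mem_ball, dist_eq_norm] using hb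
        exact add_right_cancel (hinj1 ha' hb' hab)
      have himm' : ∀ z ∈ Metric.ball (0 : ℂ) ρ₁, z ≠ 0 →
          Function.Injective (mfderiv 𝓘(ℝ, ℂ) (𝓡 4) (fun z : ℂ => G (z + c)) z) := by
        intro z hz hz0
        rw [mfderiv_comp_add_const hGs]
        refine himm1 (z + c) ?_ ?_
        · simpa [Metric.mem_ball, dist_eq_norm] using hz
        · simpa using hz0
      have key := hCusp V J hJ2 hJs N ι hιe hιs hιd (fun z : ℂ => G (z + c)) (hGc c) (hGJc c)
        ρ₁ hρ₁ hinj' himm' (fun n z => u n (z + c)) (fun n => huc n c) (fun n => huJc n c)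
        (fun n => huinjc n c) (fun n => huimmc n c) (hconvc c ρ₁)
      rwa [mfderiv_comp_add_const hGs, zero_add] at key
    · exact h2
  -- (6) the non-injectivity locus
  set B : Set ℂ := Metric.ball (0 : ℂ) r₁ with hBdef
  set Nn : Set ℂ := {t | t ∈ B ∧ ∃ s ∈ B, s ≠ t ∧ G s = G t} with hNdef
  have hNB : Nn ⊆ B := fun t ht => ht.1
  have hNr₀ : Nn ⊆ Metric.closedBall (0 : ℂ) r₀ := by
    rintro t ⟨htB, s, hsB, hst, hG⟩
    exact mem_closedBall_zero_iff.2
      (O1 s t (mem_ball_zero_iff.1 hsB) (mem_ball_zero_iff.1 htB) hst hG).1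
  have hclNr₀ : closure Nn ⊆ Metric.closedBall (0 : ℂ) r₀ :=
    closure_minimal hNr₀ Metric.isClosed_closedBall
  have hr₀B : Metric.closedBall (0 : ℂ) r₀ ⊆ B := Metric.closedBall_subset_ball hr₁
  have hclNB : closure Nn ⊆ B := hclNr₀.trans hr₀B
  -- a punctured neighbourhood of a critical point of `B` lies in `Nn`
  have hMCN : ∀ c ∈ B, ¬ Function.Injective (mfderiv 𝓘(ℝ, ℂ) (𝓡 4) G c) →
      ∃ ρ' : ℝ, 0 < ρ' ∧ ∀ t ∈ Metric.ball c ρ', t ≠ c → t ∈ Nn := by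
    intro c hcB hc
    have hρ : 0 < r₁ - ‖c‖ := sub_pos.2 (mem_ball_zero_iff.1 hcB)
    obtain ⟨ρ', hρ', h⟩ := hMC c hc (r₁ - ‖c‖) hρ
    refine ⟨min ρ' (r₁ - ‖c‖), lt_min hρ' hρ, fun t ht htc => ?_⟩
    have ht1 : t ∈ Metric.ball c ρ' := Metric.ball_subset_ball (min_le_left _ _) ht
    have htB : t ∈ B :=
      ball_sub_norm_subset_ball c r₁ (Metric.ball_subset_ball (min_le_right _ _) ht)
    obtain ⟨s, hs, hst, hG⟩ := h t ht1 htc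
    exact ⟨htB, s, ball_sub_norm_subset_ball c r₁ hs, hst, hG⟩
  -- `Nn` is open
  have hNopen : ∀ t ∈ Nn, ∃ ρ : ℝ, 0 < ρ ∧ Metric.ball t ρ ⊆ Nn := by
    rintro t ⟨htB, s, hsB, hst, hGst⟩
    have hd : 0 < ‖s - t‖ / 2 := by
      have : 0 < ‖s - t‖ := norm_pos_iff.2 (sub_ne_zero.2 hst)
      linarith
    by_cases hreg : Function.Injective (mfderiv 𝓘(ℝ, ℂ) (𝓡 4) G t)
    · have h0 : (fun z : ℂ => G (z + s)) 0 = (fun z : ℂ => G (z + t)) 0 := by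
        simp only [zero_add, hGst]
      have hreg' : Function.Injective (mfderiv 𝓘(ℝ, ℂ) (𝓡 4) (fun z : ℂ => G (z + t)) 0) := by
        rw [mfderiv_comp_add_const hGs, zero_add]; exact hreg
      rcases hInt V J hJ2 hJs (fun z : ℂ => G (z + s)) (fun z : ℂ => G (z + t)) (hGc s)
        (hGJc s) (hGc t) (hGJc t) h0 hreg' (NCs s) with ⟨ρ₃, hρ₃, hiso⟩ | hco
      · -- isolated: the embedded approximants would meet (positivity / persistence)
        exfalso
        set ρ₄ : ℝ := min ρ₃ (‖s - t‖ / 2) with hρ₄def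
        have hρ₄ : 0 < ρ₄ := lt_min hρ₃ hd
        have hiso' : ∀ a ∈ Metric.ball (0 : ℂ) ρ₄, ∀ b ∈ Metric.ball (0 : ℂ) ρ₄,
            G (a + s) = G (b + t) → a = 0 ∧ b = 0 := fun a ha b hb h =>
          hiso a (Metric.ball_subset_ball (min_le_left _ _) ha) b
            (Metric.ball_subset_ball (min_le_left _ _) hb) h
        have hev := hPos V J hJ2 hJs N ι hιe hιs hιd (fun z : ℂ => G (z + s))
          (fun z : ℂ => G (z + t)) (hGc s) (hGJc s) (hGc t) (hGJc t) h0 hreg' ρ₄ hρ₄ hiso'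
          (fun n z => u n (z + s)) (fun n z => u n (z + t)) (fun n => huc n s)
          (fun n => huJc n s) (fun n => huc n t) (fun n => huJc n t) (hconvc s ρ₄) (hconvc t ρ₄)
        obtain ⟨n, a, ha, b, hb, hab⟩ := hev.exists
        have heq : a + s = b + t := huinj n hab
        have h1 : s - t = b - a := by linear_combination heq
        have ha' : ‖a‖ < ‖s - t‖ / 2 := lt_of_lt_of_le (mem_ball_zero_iff.1 ha) (min_le_right _ _)
        have hb' : ‖b‖ < ‖s - t‖ / 2 := lt_of_lt_of_le (mem_ball_zero_iff.1 hb) (min_le_right _ _)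
        have : ‖s - t‖ < ‖s - t‖ :=
          calc ‖s - t‖ = ‖b - a‖ := by rw [h1]
            _ ≤ ‖b‖ + ‖a‖ := norm_sub_le b a
            _ < ‖s - t‖ / 2 + ‖s - t‖ / 2 := add_lt_add hb' ha'
            _ = ‖s - t‖ := by ring
        exact lt_irrefl _ this
      · -- same image germ: every nearby point has a partner near `s`
        have hρ : 0 < min (‖s - t‖ / 2) (r₁ - ‖s‖) :=
          lt_min hd (sub_pos.2 (mem_ball_zero_iff.1 hsB))
        obtain ⟨ρ', hρ', -, hsub⟩ := hco _ hρ
        have hρ'' : 0 < min (min ρ' (r₁ - ‖t‖)) (‖s - t‖ / 2) :=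
          lt_min (lt_min hρ' (sub_pos.2 (mem_ball_zero_iff.1 htB))) hd
        refine ⟨_, hρ'', fun t' ht' => ?_⟩
        have ht'1 : ‖t' - t‖ < ρ' := by
          have := Metric.ball_subset_ball ((min_le_left _ _).trans (min_le_left _ _)) ht'
          rwa [Metric.mem_ball, dist_eq_norm] at this
        have ht'2 : ‖t' - t‖ < ‖s - t‖ / 2 := by
          have := Metric.ball_subset_ball (min_le_right _ _) ht'
          rwa [Metric.mem_ball, dist_eq_norm] at this
        have ht'B : t' ∈ B :=
          ball_sub_norm_subset_ball t r₁
            (Metric.ball_subset_ball ((min_le_left _ _).trans (min_le_right _ _)) ht')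
        have hmem : G t' ∈ (fun z : ℂ => G (z + t)) '' Metric.ball (0 : ℂ) ρ' :=
          ⟨t' - t, mem_ball_zero_iff.2 ht'1, by simp only [sub_add_cancel]⟩
        obtain ⟨σ, hσ, hGσ⟩ := hsub hmem
        have hσ1 : ‖σ‖ < ‖s - t‖ / 2 := lt_of_lt_of_le (mem_ball_zero_iff.1 hσ) (min_le_left _ _)
        have hσ2 : ‖σ‖ < r₁ - ‖s‖ := lt_of_lt_of_le (mem_ball_zero_iff.1 hσ) (min_le_right _ _)
        refine ⟨ht'B, σ + s, ?_, ?_, hGσ⟩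
        · rw [mem_ball_zero_iff]
          calc ‖σ + s‖ ≤ ‖σ‖ + ‖s‖ := norm_add_le _ _
            _ < (r₁ - ‖s‖) + ‖s‖ := by linarith
            _ = r₁ := by ring
        · intro h
          have h2 : s - t = (t' - t) - σ := by rw [← h]; ring
          have : ‖s - t‖ < ‖s - t‖ :=
            calc ‖s - t‖ = ‖(t' - t) - σ‖ := by rw [h2]
              _ ≤ ‖t' - t‖ + ‖σ‖ := norm_sub_le _ _
              _ < ‖s - t‖ / 2 + ‖s - t‖ / 2 := add_lt_add ht'2 hσ1
              _ = ‖s - t‖ := by ring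
          exact lt_irrefl _ this
    · obtain ⟨ρ', hρ', hp⟩ := hMCN t htB hreg
      refine ⟨ρ', hρ', fun t' ht' => ?_⟩
      by_cases h : t' = t
      · rw [h]; exact ⟨htB, s, hsB, hst, hGst⟩
      · exact hp t' ht' h
  -- `closure Nn` is open
  have hclopen : IsOpen (closure Nn) := by
    rw [Metric.isOpen_iff]
    intro t htcl
    by_cases htN : t ∈ Nn
    · obtain ⟨ρ, hρ, hsub⟩ := hNopen t htN
      exact ⟨ρ, hρ, hsub.trans subset_closure⟩
    · have htB : t ∈ B := hclNB htcl
      have hcrit : ¬ Function.Injective (mfderiv 𝓘(ℝ, ℂ) (𝓡 4) G t) := by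
        intro hreg
        obtain ⟨ρ, hρ, hinj⟩ := LI t hreg
        obtain ⟨tk, htkN, htk⟩ := mem_closure_iff_seq_limit.1 htcl
        choose sk hsk using fun k => (htkN k).2
        have hskr : ∀ k, sk k ∈ Metric.closedBall (0 : ℂ) r₀ := fun k =>
          mem_closedBall_zero_iff.2 (O1 (sk k) (tk k) (mem_ball_zero_iff.1 (hsk k).1)
            (mem_ball_zero_iff.1 (htkN k).1) (hsk k).2.1 (hsk k).2.2).2
        obtain ⟨sstar, hsstar, φ, hφ, hlim⟩ :=
          (isCompact_closedBall (0 : ℂ) r₀).tendsto_subseq hskr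
        have hcont : Continuous G := hGs.continuous
        have hGlim1 : Tendsto (fun k => G (sk (φ k))) atTop (𝓝 (G sstar)) :=
          (hcont.tendsto _).comp hlim
        have htk' : Tendsto (fun k => tk (φ k)) atTop (𝓝 t) := htk.comp hφ.tendsto_atTop
        have hGlim2 : Tendsto (fun k => G (tk (φ k))) atTop (𝓝 (G t)) :=
          (hcont.tendsto _).comp htk'
        have heqfun : (fun k => G (sk (φ k))) = fun k => G (tk (φ k)) :=
          funext fun k => (hsk (φ k)).2.2
        rw [heqfun] at hGlim1
        have hGeq : G sstar = G t := tendsto_nhds_unique hGlim1 hGlim2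
        by_cases hst : sstar = t
        · have h1 : ∀ᶠ k in atTop, sk (φ k) ∈ Metric.ball t ρ := by
            rw [← hst]; exact hlim (Metric.ball_mem_nhds _ hρ)
          have h2 : ∀ᶠ k in atTop, tk (φ k) ∈ Metric.ball t ρ := htk' (Metric.ball_mem_nhds _ hρ)
          obtain ⟨k, hk1, hk2⟩ := (h1.and h2).exists
          exact (hsk (φ k)).2.1 (hinj hk1 hk2 (hsk (φ k)).2.2)
        · exact htN ⟨htB, sstar, hr₀B hsstar, hst, hGeq⟩
      obtain ⟨ρ', hρ', hp⟩ := hMCN t htB hcrit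
      refine ⟨ρ', hρ', fun t' ht' => ?_⟩
      by_cases h : t' = t
      · rw [h]; exact htcl
      · exact subset_closure (hp t' ht' h)
  -- clopen in the connected disc, inside the inner closed disc: empty
  have hNempty : ∀ t, t ∉ Nn := by
    have hpre : IsPreconnected B := (convex_ball (0 : ℂ) r₁).isPreconnected
    rcases hpre.subset_or_subset hclopen isClosed_closure.isOpen_compl disjoint_compl_right
        (by rw [Set.union_compl_self]; exact subset_univ _) with h | h
    · exfalso
      have hξ₀B : ξ₀ ∈ B := mem_ball_zero_iff.2 hξ₀A.2
      have := mem_closedBall_zero_iff.1 (hclNr₀ (h hξ₀B))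
      linarith [hξ₀A.1]
    · intro t ht
      exact h (hNB ht) (subset_closure ht)
  -- conclusion
  refine ⟨?_, ?_⟩
  · intro s hs t ht hG
    by_contra hne
    exact hNempty t ⟨ht, s, hs, hne, hG⟩
  · intro ξ hξ
    by_contra hni
    obtain ⟨ρ', hρ', hp⟩ := hMCN ξ hξ hni
    have hmem : ξ + ((ρ' / 2 : ℝ) : ℂ) ∈ Metric.ball ξ ρ' := by
      rw [Metric.mem_ball, dist_eq_norm, add_sub_cancel_left, Complex.norm_real, Real.norm_eq_abs,
        abs_of_pos (by linarith)]
      linarith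
    have hne : ξ + ((ρ' / 2 : ℝ) : ℂ) ≠ ξ := by
      intro h
      have : ((ρ' / 2 : ℝ) : ℂ) = 0 := by simpa using h
      have : (ρ' / 2 : ℝ) = 0 := by exact_mod_cast this
      linarith
    exact hNempty _ (hp _ hmem hne)

end Summit.SmoothPoincare4.SmoothPoincare4.Theorems.WitnessCharge.PencilIncompleteness
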